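import Summits.QuantumFields.YangMills.Theorems.ColdStartUniversalityLatticeLangevinLiebRobinsonCarreOfLipschitz
import Summits.QuantumFields.YangMills.Theorems.ColdStartUniversalityLatticeLangevinWeightedDynkinSlope
import HarnessLib

/-!
# Route `ColdStartUniversality` (fixed-cut-off SZZ dynamics; LIEB–ROBINSON / LOCALITY package, file 14):
# LOCALITY OF THE DIRICHLET ENERGY — only links carrying BOTH observables contribute

Helper file (seat `ym-line-csu-p1`, g31; `--supports stmt-QuantumFields-24809`).  Static input of the dynamic proof of EXPONENTIAL
CLUSTERING of the `SU(2)` Wilson measure `μ_(β')` on `(ℤ/L)³` (files 14–17 of the package: Lieb–Robinson bound + spectral gap ⇒ clustering,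
the Hastings–Koma mechanism in a classical diffusion setting; Shen–Zhu–Zhu CMP 400 (2023) §4.3 shape).  For every coupling `β'` and volume `L`:
* ★★ `abs_carre_bilin_le_of_linkLipschitz` — if `a, b` are `C¹` and `a∘coords`, `b∘coords` are `m_e`- resp. `ℓ_e`-Lipschitz in the link `e`
  (Frobenius distance of the link matrices, other links frozen), then `|Γ^A(a,b)(V)| ≤ 16·Σ_e m_e ℓ_e` at every configuration
  (frame dictionary `carre_eq_sum_frameDeriv_mul` + `frameDeriv_abs_le_of_linkLipschitz`);
* ★★ `abs_integral_mul_generator_le_of_linkLipschitz` — for `C³` compactly supported `a, b`: `|∫ (a∘coords)·𝓛b dμ_(β')| ≤ 8·Σ_e m_e ℓ_e`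
  (bilinear energy identity `2∫ A·𝓛b dμ = −∫ Γ(a,b) dμ`, `two_mul_integral_mul_generator_bilin_eq_neg_carre`).
THEOREMS ONLY, no definition, no sorry; [folklore] / [cite: ShenZhuZhu2022, §3 (Dirichlet form, p. 13)].  HONEST FRAMING: fixed cut-off, static
bookkeeping valid at every coupling; nothing `K`-uniform; `UniformColdStartMixing` (24809) is NOT restated; no crux, rung or summit statement is
proved; the Yang–Mills mass gap is NOT proved.
-/

set_option autoImplicit false

noncomputable section

namespace Summit.QuantumFields.YangMills.Theorems.ColdStartUniversality.LiebRobinson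

open MeasureTheory ProbabilityTheory Matrix Complex Finset Filter Set Metric intervalIntegral
open scoped ComplexConjugate BigOperators Matrix NNReal ENNReal Topology
open Literature.Probability.Process Literature.MathematicalPhysics.QuantumFieldTheory
open Literature.MathematicalPhysics.QuantumFieldTheory.Balaban1983to89
open Literature.MathematicalPhysics.QuantumLattice (fundamentalRep fundamentalLatticeRep continuous_fundamentalRep fundamentalRep_apply)

variable {L : ℕ} [NeZero L]

/-! ## §1. The bilinear carré du champ from two link-Lipschitz profiles -/

/-- ★★ **Bilinear carré du champ from two link-Lipschitz profiles.**  If `a, b` are `C¹` and `a∘coords`, `b∘coords` are `m_e`- resp.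
`ℓ_e`-Lipschitz in the link `e` (Frobenius distance of the link matrices, all other links frozen) for every `e`, then at EVERY configuration
`|Γ^A(a,b)(V)| ≤ 16·Σ_e m_e ℓ_e`: by the frame dictionary `Γ^A(a,b) = Σ_n W_n a·W_n b` (`carre_eq_sum_frameDeriv_mul`), `8` noise directions
per link and `|W_(e,ν)a| ≤ √2 m_e`, `|W_(e,ν)b| ≤ √2 ℓ_e` (`frameDeriv_abs_le_of_linkLipschitz`).  Only links where BOTH observables vary
contribute. [folklore] -/
theorem abs_carre_bilin_le_of_linkLipschitz (L : ℕ) [NeZero L] (β' : ℝ) {a b : (Edge 3 L × Fin 2 × Fin 2 × Bool → ℝ) → ℝ}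
    (ha : ContDiff ℝ 1 a) (hb : ContDiff ℝ 1 b) {m ℓ : Edge 3 L → ℝ} (hm : ∀ e, 0 ≤ m e) (hℓ : ∀ e, 0 ≤ ℓ e)
    (V : (GaugeConfig 3 L (Matrix.specialUnitaryGroup (Fin 2) ℂ))) :
    let coords : GaugeConfig 3 L (Matrix.specialUnitaryGroup (Fin 2) ℂ) → (Edge 3 L × Fin 2 × Fin 2 × Bool → ℝ) :=
      fun V q => (fun z : ℂ => if q.2.2.2 then z.im else z.re)
        ((fundamentalRep (Fin 2) (V q.1) : Matrix (Fin 2) (Fin 2) ℂ) q.2.1 q.2.2.1)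
    let A : GaugeConfig 3 L (Matrix.specialUnitaryGroup (Fin 2) ℂ) → (Edge 3 L × Fin 2 × Fin 2 × Bool) →
        (Edge 3 L × Fin 2 × Fin 2 × Bool) → ℝ := fun V i j =>
      ∑ n : Edge 3 L × NoiseIdx 2,
        (if n.1 = i.1 then (fun z : ℂ => if i.2.2.2 then z.im else z.re)
          ((latticeLangevinDynamics (fundamentalLatticeRep 2) β').noise
            (matrixConfig (fundamentalRep (Fin 2)) V) i.1 n.2 i.2.1 i.2.2.1) else 0) *
        (if n.1 = j.1 then (fun z : ℂ => if j.2.2.2 then z.im else z.re)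
          ((latticeLangevinDynamics (fundamentalLatticeRep 2) β').noise
            (matrixConfig (fundamentalRep (Fin 2)) V) j.1 n.2 j.2.1 j.2.2.1) else 0)
    (∀ (e : Edge 3 L) (y y' : (GaugeConfig 3 L (Matrix.specialUnitaryGroup (Fin 2) ℂ))), (∀ f, f ≠ e → y f = y' f) →
      |a (coords y) - a (coords y')| ≤ m e * frobNorm ((y e : Matrix (Fin 2) (Fin 2) ℂ) - (y' e : Matrix (Fin 2) (Fin 2) ℂ))) →
    (∀ (e : Edge 3 L) (y y' : (GaugeConfig 3 L (Matrix.specialUnitaryGroup (Fin 2) ℂ))), (∀ f, f ≠ e → y f = y' f) →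
      |b (coords y) - b (coords y')| ≤ ℓ e * frobNorm ((y e : Matrix (Fin 2) (Fin 2) ℂ) - (y' e : Matrix (Fin 2) (Fin 2) ℂ))) →
    |∑ i : Edge 3 L × Fin 2 × Fin 2 × Bool, ∑ j : Edge 3 L × Fin 2 × Fin 2 × Bool,
        fderiv ℝ a (coords V) (Pi.single i 1) * fderiv ℝ b (coords V) (Pi.single j 1) * A V i j| ≤
      16 * ∑ e : Edge 3 L, m e * ℓ e := by
  intro coords A hLa hLb
  classical
  have hframe := carre_eq_sum_frameDeriv_mul L β' a b V
  rw [hframe]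
  have hba : ∀ n : Edge 3 L × NoiseIdx (fundamentalLatticeRep 2).N,
      |fderiv ℝ a (coords V) (fun q : Edge 3 L × Fin (fundamentalLatticeRep 2).N × Fin (fundamentalLatticeRep 2).N × Bool => if n.1 = q.1 then (fun z : ℂ => if q.2.2.2 then z.im else z.re) (((Real.sqrt 2 : ℂ) • ((fundamentalLatticeRep 2).lieProj (noiseDir n.2) * (fun (ee : Edge 3 L) => Matrix.of fun (i j : Fin (fundamentalLatticeRep 2).N) => ((coords V (ee, i, j, false) : ℝ) : ℂ) + ((coords V (ee, i, j, true) : ℝ) : ℂ) * Complex.I) q.1)) q.2.1 q.2.2.1) else 0)| ≤ Real.sqrt 2 * m n.1 :=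
    fun n => frameDeriv_abs_le_of_linkLipschitz ha n (hm n.1) (fun y y' h => hLa n.1 y y' h) V
  have hbb : ∀ n : Edge 3 L × NoiseIdx (fundamentalLatticeRep 2).N,
      |fderiv ℝ b (coords V) (fun q : Edge 3 L × Fin (fundamentalLatticeRep 2).N × Fin (fundamentalLatticeRep 2).N × Bool => if n.1 = q.1 then (fun z : ℂ => if q.2.2.2 then z.im else z.re) (((Real.sqrt 2 : ℂ) • ((fundamentalLatticeRep 2).lieProj (noiseDir n.2) * (fun (ee : Edge 3 L) => Matrix.of fun (i j : Fin (fundamentalLatticeRep 2).N) => ((coords V (ee, i, j, false) : ℝ) : ℂ) + ((coords V (ee, i, j, true) : ℝ) : ℂ) * Complex.I) q.1)) q.2.1 q.2.2.1) else 0)| ≤ Real.sqrt 2 * ℓ n.1 :=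
    fun n => frameDeriv_abs_le_of_linkLipschitz hb n (hℓ n.1) (fun y y' h => hLb n.1 y y' h) V
  have hterm : ∀ n : Edge 3 L × NoiseIdx (fundamentalLatticeRep 2).N,
      |fderiv ℝ a (coords V) (fun q : Edge 3 L × Fin (fundamentalLatticeRep 2).N × Fin (fundamentalLatticeRep 2).N × Bool => if n.1 = q.1 then (fun z : ℂ => if q.2.2.2 then z.im else z.re) (((Real.sqrt 2 : ℂ) • ((fundamentalLatticeRep 2).lieProj (noiseDir n.2) * (fun (ee : Edge 3 L) => Matrix.of fun (i j : Fin (fundamentalLatticeRep 2).N) => ((coords V (ee, i, j, false) : ℝ) : ℂ) + ((coords V (ee, i, j, true) : ℝ) : ℂ) * Complex.I) q.1)) q.2.1 q.2.2.1) else 0) * fderiv ℝ b (coords V) (fun q : Edge 3 L × Fin (fundamentalLatticeRep 2).N × Fin (fundamentalLatticeRep 2).N × Bool => if n.1 = q.1 then (fun z : ℂ => if q.2.2.2 then z.im else z.re) (((Real.sqrt 2 : ℂ) • ((fundamentalLatticeRep 2).lieProj (noiseDir n.2) * (fun (ee : Edge 3 L) => Matrix.of fun (i j : Fin (fundamentalLatticeRep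 2).N) => ((coords V (ee, i, j, false) : ℝ) : ℂ) + ((coords V (ee, i, j, true) : ℝ) : ℂ) * Complex.I) q.1)) q.2.1 q.2.2.1) else 0)| ≤ 2 * (m n.1 * ℓ n.1) := by
    intro n
    rw [abs_mul]
    have hs : Real.sqrt 2 * Real.sqrt 2 = 2 := Real.mul_self_sqrt (by norm_num)
    calc |fderiv ℝ a (coords V) (fun q : Edge 3 L × Fin (fundamentalLatticeRep 2).N × Fin (fundamentalLatticeRep 2).N × Bool => if n.1 = q.1 then (fun z : ℂ => if q.2.2.2 then z.im else z.re) (((Real.sqrt 2 : ℂ) • ((fundamentalLatticeRep 2).lieProj (noiseDir n.2) * (fun (ee : Edge 3 L) => Matrix.of fun (i j : Fin (fundamentalLatticeRep 2).N) => ((coords V (ee, i, j, false) : ℝ) : ℂ) + ((coords V (ee, i, j, true) : ℝ) : ℂ) * Complex.I) q.1)) q.2.1 q.2.2.1) else 0)| * |fderiv ℝ b (coords V) (fun q : Edge 3 L × Fin (fundamentalLatticeRep 2).N × Fin (fundamentalLatticeRep 2).N × Bool => if n.1 = q.1 then (fun z : ℂ => if q.2.2.2 then z.im else z.re) (((Real.sqrt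 2 : ℂ) • ((fundamentalLatticeRep 2).lieProj (noiseDir n.2) * (fun (ee : Edge 3 L) => Matrix.of fun (i j : Fin (fundamentalLatticeRep 2).N) => ((coords V (ee, i, j, false) : ℝ) : ℂ) + ((coords V (ee, i, j, true) : ℝ) : ℂ) * Complex.I) q.1)) q.2.1 q.2.2.1) else 0)|
        ≤ (Real.sqrt 2 * m n.1) * (Real.sqrt 2 * ℓ n.1) :=
          mul_le_mul (hba n) (hbb n) (abs_nonneg _) (mul_nonneg (Real.sqrt_nonneg 2) (hm n.1))
      _ = (Real.sqrt 2 * Real.sqrt 2) * (m n.1 * ℓ n.1) := by ring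
      _ = 2 * (m n.1 * ℓ n.1) := by rw [hs]
  have hcard8 : Fintype.card (NoiseIdx (fundamentalLatticeRep 2).N) = 8 := by
    rw [Literature.MathematicalPhysics.QuantumLattice.fundamentalLatticeRep_N]; rfl
  calc |∑ n : Edge 3 L × NoiseIdx (fundamentalLatticeRep 2).N, fderiv ℝ a (coords V) (fun q : Edge 3 L × Fin (fundamentalLatticeRep 2).N × Fin (fundamentalLatticeRep 2).N × Bool => if n.1 = q.1 then (fun z : ℂ => if q.2.2.2 then z.im else z.re) (((Real.sqrt 2 : ℂ) • ((fundamentalLatticeRep 2).lieProj (noiseDir n.2) * (fun (ee : Edge 3 L) => Matrix.of fun (i j : Fin (fundamentalLatticeRep 2).N) => ((coords V (ee, i, j, false) : ℝ) : ℂ) + ((coords V (ee, i, j, true) : ℝ) : ℂ) * Complex.I) q.1)) q.2.1 q.2.2.1) else 0) * fderiv ℝ b (coords V) (fun q : Edge 3 L × Fin (fundamentalLatticeRep 2).N × Fin (fundamentalLatticeRep 2).N × Bool => if n.1 = q.1 then (fun z : ℂ => if q.2.2.2 then z.im else z.re) (((Real.sqrt 2 : ℂ) • ((fundamentalLatticeRep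 2).lieProj (noiseDir n.2) * (fun (ee : Edge 3 L) => Matrix.of fun (i j : Fin (fundamentalLatticeRep 2).N) => ((coords V (ee, i, j, false) : ℝ) : ℂ) + ((coords V (ee, i, j, true) : ℝ) : ℂ) * Complex.I) q.1)) q.2.1 q.2.2.1) else 0)|
      ≤ ∑ n : Edge 3 L × NoiseIdx (fundamentalLatticeRep 2).N, |fderiv ℝ a (coords V) (fun q : Edge 3 L × Fin (fundamentalLatticeRep 2).N × Fin (fundamentalLatticeRep 2).N × Bool => if n.1 = q.1 then (fun z : ℂ => if q.2.2.2 then z.im else z.re) (((Real.sqrt 2 : ℂ) • ((fundamentalLatticeRep 2).lieProj (noiseDir n.2) * (fun (ee : Edge 3 L) => Matrix.of fun (i j : Fin (fundamentalLatticeRep 2).N) => ((coords V (ee, i, j, false) : ℝ) : ℂ) + ((coords V (ee, i, j, true) : ℝ) : ℂ) * Complex.I) q.1)) q.2.1 q.2.2.1) else 0) * fderiv ℝ b (coords V) (fun q : Edge 3 L × Fin (fundamentalLatticeRep 2).N × Fin (fundamentalLatticeRep 2).N × Bool => if n.1 = q.1 then (fun z : ℂ => if q.2.2.2 then z.im else z.re)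 (((Real.sqrt 2 : ℂ) • ((fundamentalLatticeRep 2).lieProj (noiseDir n.2) * (fun (ee : Edge 3 L) => Matrix.of fun (i j : Fin (fundamentalLatticeRep 2).N) => ((coords V (ee, i, j, false) : ℝ) : ℂ) + ((coords V (ee, i, j, true) : ℝ) : ℂ) * Complex.I) q.1)) q.2.1 q.2.2.1) else 0)| :=
        Finset.abs_sum_le_sum_abs _ _
    _ ≤ ∑ n : Edge 3 L × NoiseIdx (fundamentalLatticeRep 2).N, 2 * (m n.1 * ℓ n.1) := Finset.sum_le_sum fun n _ => hterm n
    _ = ∑ e : Edge 3 L, ∑ _ν : NoiseIdx (fundamentalLatticeRep 2).N, 2 * (m e * ℓ e) := by rw [Fintype.sum_prod_type]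
    _ = ∑ e : Edge 3 L, 8 * (2 * (m e * ℓ e)) := by
        refine Finset.sum_congr rfl fun e _ => ?_
        rw [Finset.sum_const, Finset.card_univ, hcard8, nsmul_eq_mul]
        push_cast; ring
    _ = 16 * ∑ e : Edge 3 L, m e * ℓ e := by rw [Finset.mul_sum]; exact Finset.sum_congr rfl fun e _ => by ring

/-! ## §2. Locality of the energy -/

/-- ★★ **LOCALITY OF THE DIRICHLET ENERGY.**  For every coupling `β'` and torus size `L`: if `a, b` are `C³` compactly supported
functions of the real link coordinates whose pull-backs `a∘coords`, `b∘coords` have link-Lipschitz profiles `m`, `ℓ ≥ 0`, then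
`|∫ (a∘coords)·𝓛b dμ_(β')| ≤ 8·Σ_e m_e ℓ_e` — the bilinear energy identity `2∫ A·𝓛b dμ = −∫ Γ(a,b) dμ`
(`two_mul_integral_mul_generator_bilin_eq_neg_carre`) and `abs_carre_bilin_le_of_linkLipschitz`.  In particular the energy vanishes when
no link carries both observables. [cite: ShenZhuZhu2022, §3 (Dirichlet form 𝓔^L, p. 13)] -/
theorem abs_integral_mul_generator_le_of_linkLipschitz (L : ℕ) [NeZero L] (β' : ℝ)
    {a b : (Edge 3 L × Fin 2 × Fin 2 × Bool → ℝ) → ℝ} (ha : ContDiff ℝ 3 a) (hac : HasCompactSupport a)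
    (hb : ContDiff ℝ 3 b) (hbc : HasCompactSupport b) {m ℓ : Edge 3 L → ℝ} (hm : ∀ e, 0 ≤ m e) (hℓ : ∀ e, 0 ≤ ℓ e) :
    let coords : GaugeConfig 3 L (Matrix.specialUnitaryGroup (Fin 2) ℂ) → (Edge 3 L × Fin 2 × Fin 2 × Bool → ℝ) :=
      fun V q => (fun z : ℂ => if q.2.2.2 then z.im else z.re)
        ((fundamentalRep (Fin 2) (V q.1) : Matrix (Fin 2) (Fin 2) ℂ) q.2.1 q.2.2.1)
    let gen : GaugeConfig 3 L (Matrix.specialUnitaryGroup (Fin 2) ℂ) → ℝ := fun V =>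
      (∑ i : Edge 3 L × Fin 2 × Fin 2 × Bool, fderiv ℝ b (coords V) (Pi.single i 1) *
          (fun z : ℂ => if i.2.2.2 then z.im else z.re)
            ((latticeLangevinDynamics (fundamentalLatticeRep 2) β').drift
              (matrixConfig (fundamentalRep (Fin 2)) V) i.1 i.2.1 i.2.2.1) +
      1 / 2 * ∑ i : Edge 3 L × Fin 2 × Fin 2 × Bool, ∑ j : Edge 3 L × Fin 2 × Fin 2 × Bool,
        fderiv ℝ (fun z => fderiv ℝ b z (Pi.single i 1)) (coords V) (Pi.single j 1) *
          ∑ n : Edge 3 L × NoiseIdx 2,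
            (if n.1 = i.1 then (fun z : ℂ => if i.2.2.2 then z.im else z.re)
              ((latticeLangevinDynamics (fundamentalLatticeRep 2) β').noise
                (matrixConfig (fundamentalRep (Fin 2)) V) i.1 n.2 i.2.1 i.2.2.1) else 0) *
            (if n.1 = j.1 then (fun z : ℂ => if j.2.2.2 then z.im else z.re)
              ((latticeLangevinDynamics (fundamentalLatticeRep 2) β').noise
                (matrixConfig (fundamentalRep (Fin 2)) V) j.1 n.2 j.2.1 j.2.2.1) else 0))
    (∀ (e : Edge 3 L) (y y' : (GaugeConfig 3 L (Matrix.specialUnitaryGroup (Fin 2) ℂ))), (∀ f, f ≠ e → y f = y' f) →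
      |a (coords y) - a (coords y')| ≤ m e * frobNorm ((y e : Matrix (Fin 2) (Fin 2) ℂ) - (y' e : Matrix (Fin 2) (Fin 2) ℂ))) →
    (∀ (e : Edge 3 L) (y y' : (GaugeConfig 3 L (Matrix.specialUnitaryGroup (Fin 2) ℂ))), (∀ f, f ≠ e → y f = y' f) →
      |b (coords y) - b (coords y')| ≤ ℓ e * frobNorm ((y e : Matrix (Fin 2) (Fin 2) ℂ) - (y' e : Matrix (Fin 2) (Fin 2) ℂ))) →
    |∫ V, a (coords V) * gen V ∂(wilsonMeasure (d := 3) (L := L) (fundamentalRep (Fin 2)) β')| ≤ 8 * ∑ e : Edge 3 L, m e * ℓ e := by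
  intro coords gen hLa hLb
  classical
  haveI := secondCountableTopology_su2
  haveI := borelSpace_config L
  set μ : Measure (GaugeConfig 3 L (Matrix.specialUnitaryGroup (Fin 2) ℂ)) :=
    wilsonMeasure (d := 3) (L := L) (fundamentalRep (Fin 2)) β' with hμ
  haveI : IsProbabilityMeasure μ :=
    isProbabilityMeasure_wilsonMeasure (d := 3) (L := L) (fundamentalRep (Fin 2)) (continuous_fundamentalRep (Fin 2)) β'
  have hbil := two_mul_integral_mul_generator_bilin_eq_neg_carre L β' ha hac hb hbc
  have hpt := fun V : (GaugeConfig 3 L (Matrix.specialUnitaryGroup (Fin 2) ℂ)) =>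
    abs_carre_bilin_le_of_linkLipschitz L β' (ha.of_le (by norm_num)) (hb.of_le (by norm_num)) hm hℓ V hLa hLb
  have hI : |∫ V, (∑ i : Edge 3 L × Fin 2 × Fin 2 × Bool, ∑ j : Edge 3 L × Fin 2 × Fin 2 × Bool,
        fderiv ℝ a (coords V) (Pi.single i 1) * fderiv ℝ b (coords V) (Pi.single j 1) *
          ∑ n : Edge 3 L × NoiseIdx 2,
            (if n.1 = i.1 then (fun z : ℂ => if i.2.2.2 then z.im else z.re)
              ((latticeLangevinDynamics (fundamentalLatticeRep 2) β').noise
                (matrixConfig (fundamentalRep (Fin 2)) V) i.1 n.2 i.2.1 i.2.2.1) else 0) *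
            (if n.1 = j.1 then (fun z : ℂ => if j.2.2.2 then z.im else z.re)
              ((latticeLangevinDynamics (fundamentalLatticeRep 2) β').noise
                (matrixConfig (fundamentalRep (Fin 2)) V) j.1 n.2 j.2.1 j.2.2.1) else 0)) ∂μ| ≤
      16 * ∑ e : Edge 3 L, m e * ℓ e := by
    refine (MeasureTheory.abs_integral_le_integral_abs).trans ?_
    calc ∫ V, |∑ i : Edge 3 L × Fin 2 × Fin 2 × Bool, ∑ j : Edge 3 L × Fin 2 × Fin 2 × Bool,
        fderiv ℝ a (coords V) (Pi.single i 1) * fderiv ℝ b (coords V) (Pi.single j 1) *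
          ∑ n : Edge 3 L × NoiseIdx 2,
            (if n.1 = i.1 then (fun z : ℂ => if i.2.2.2 then z.im else z.re)
              ((latticeLangevinDynamics (fundamentalLatticeRep 2) β').noise
                (matrixConfig (fundamentalRep (Fin 2)) V) i.1 n.2 i.2.1 i.2.2.1) else 0) *
            (if n.1 = j.1 then (fun z : ℂ => if j.2.2.2 then z.im else z.re)
              ((latticeLangevinDynamics (fundamentalLatticeRep 2) β').noise
                (matrixConfig (fundamentalRep (Fin 2)) V) j.1 n.2 j.2.1 j.2.2.1) else 0)| ∂μ
        ≤ ∫ _V, 16 * ∑ e : Edge 3 L, m e * ℓ e ∂μ :=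
          integral_mono_of_nonneg (Eventually.of_forall fun V => abs_nonneg _) (integrable_const _)
            (Eventually.of_forall fun V => hpt V)
      _ = 16 * ∑ e : Edge 3 L, m e * ℓ e := by rw [MeasureTheory.integral_const, smul_eq_mul, probReal_univ, one_mul]
  have h2 : 2 * |∫ V, a (coords V) * gen V ∂μ| ≤ 16 * ∑ e : Edge 3 L, m e * ℓ e := by
    have e2 : 2 * |∫ V, a (coords V) * gen V ∂μ| = |2 * ∫ V, a (coords V) * gen V ∂μ| := by
      rw [abs_mul, abs_of_pos (by norm_num : (0:ℝ) < 2)]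
    rw [e2]
    have e3 : (2 * ∫ V, a (coords V) * gen V ∂μ) = _ := hbil
    rw [e3, abs_neg]
    exact hI
  linarith



end Summit.QuantumFields.YangMills.Theorems.ColdStartUniversality.LiebRobinson
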